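import Summits.NavierStokesRegularity.NavierStokesRegularity.Theses.HodographBetchov
import Summits.NavierStokesRegularity.NavierStokesRegularity.Theorems.HodographBetchovClassBudgetsRegularise
import Summits.NavierStokesRegularity.NavierStokesRegularity.Theorems.HodographBetchovFastClassSqueezeOfBounded
import Summits.NavierStokesRegularity.NavierStokesRegularity.Theorems.HodographBetchovSlowClassProductionGermIff
import Summits.NavierStokesRegularity.NavierStokesRegularity.Theorems.BlowupAssembly
import Summits.NavierStokesRegularity.NavierStokesRegularity.Theorems.AdiabaticEddyClayUniqueness

/-!
# Route `HodographBetchov` is an equivalent reformulation of Clay (A)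

Helper file for the crux item stmt-NavierStokesRegularity-15832 (`FastClassSqueeze`; it serves
stmt-NavierStokesRegularity-15831, `SlowClassProduction`, equally). With the bridge crux
`ClassBudgetsRegularise` (stmt-16863) and the assembly (stmt-16864) proved, the route's deciding
theorem `Theses.HodographBetchov.closes` consumes exactly the two open cruxes. This file pins down
their logical position by tree theorems (none closes either crux):

* `HodographBetchov.noBlowup_of_navierStokesRegularity` — Clay (A) ⇒ no first-time blow-up of a
  classical Leray–Hopf solution from a rapidly decaying datum (the tree's `blowup_assembly` run
  against the PROVED Clay-class uniqueness `adiabaticEddy_clayUniqueness_proof`, X5b);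
* `HodographBetchov.fastClassSqueeze_of_navierStokesRegularity`,
  `HodographBetchov.slowClassProduction_of_navierStokesRegularity` — **NECESSITY**: the summit
  statement implies each crux (through `FastClassSqueeze.fastClassSqueeze_of_noBlowup` and
  `SlowClassProduction.NearField.slowClassProduction_of_noBlowup`); so neither crux can be refuted
  without refuting Clay (A) itself (`HodographBetchov.not_navierStokesRegularity_of_not_fastClassSqueeze`,
  `HodographBetchov.not_navierStokesRegularity_of_not_slowClassProduction`);
* `HodographBetchov.navierStokesRegularity_iff_classBudgets` — **EQUIVALENCE**:
  `NavierStokesRegularity ↔ SlowClassProduction ∧ FastClassSqueeze` (sufficiency is `closes` fed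
  with `classBudgetsRegularise_proof`); and given either crux, the other is equivalent to the summit
  (`HodographBetchov.fastClassSqueeze_iff_navierStokesRegularity`,
  `HodographBetchov.slowClassProduction_iff_navierStokesRegularity`).

So the pair of open cruxes is, kernel-checked, exactly as hard as the Millennium statement, and
each one alone is a necessary condition for it.

References: E. Miller, Arch. Ration. Mech. Anal. 235 (2020) = arXiv:1710.05569, Thm. 1.1;
T. Tao, Anal. PDE 6 (2013), Cor. 11.4 (uniqueness in the Clay class); J. T. Beale, T. Kato,
A. Majda, Comm. Math. Phys. 94 (1984), §1 (maximal interval of smooth existence).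
-/

noncomputable section

open Set MeasureTheory Filter Topology Function

-- the summit and its single sub-problem share the name (CONVENTIONS §1), as in every Theorems file
set_option linter.dupNamespace false

namespace Summit.NavierStokesRegularity.NavierStokesRegularity.Theorems.HodographBetchov

open Literature.Analysis Literature.Analysis.FluidPDE
open Summit.NavierStokesRegularity.NavierStokesRegularity.Theses.HodographBetchov

/-- **Clay (A) ⇒ no blow-up.** If `NavierStokesRegularity` holds then every classical solution
`(u, p)` of the unforced Navier–Stokes system on `ℝ³ × [0, T)`, `T > 0`, which is Leray–Hopf from
its rapidly decaying datum `u 0`, extends smoothly past `T`. Proof: otherwise `(u, p)` is a maximal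
smooth solution with lifespan `T`, and the tree's `blowup_assembly` — fed with the proved uniqueness
of Clay-class solutions against classical Leray–Hopf ones (`adiabaticEddy_clayUniqueness_proof`,
item X5b) — refutes (A). [cite: Tao2011, Cor. 11.4] -/
theorem noBlowup_of_navierStokesRegularity (hA : _root_.NavierStokesRegularity) :
    ∀ (ν T : ℝ), 0 < ν → 0 < T →
      ∀ (u : ℝ → EuclideanSpace ℝ (Fin 3) → EuclideanSpace ℝ (Fin 3))
        (p : ℝ → EuclideanSpace ℝ (Fin 3) → ℝ),
        IsClassicalNSSolutionOn (Set.Ico 0 T) ν 0 u p → IsLerayHopfOn T ν 0 (u 0) u →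
        HasRapidSpatialDecay (u 0) → HasSmoothExtensionPast ν 0 u T := by
  intro ν T hν hT u p hcl hLH hdec
  by_contra hext
  exact Literature.NS.blowup_assembly
    ⟨⟨ν, hν, T, hT, u, p, ⟨hcl, hext⟩, hLH, hdec⟩, adiabaticEddy_clayUniqueness_proof⟩ hA

/-- **NECESSITY for crux 3: `NavierStokesRegularity → FastClassSqueeze`.** Clay (A) rules out
blow-up (`noBlowup_of_navierStokesRegularity`), and without blow-up the fast-class squeeze is
trivial (`FastClassSqueeze.fastClassSqueeze_of_noBlowup`: a solution that extends past `T` is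
bounded on `[0, T) × ℝ³`, so its fast class at a level above the bound is empty). [folklore] -/
theorem fastClassSqueeze_of_navierStokesRegularity (hA : _root_.NavierStokesRegularity) :
    FastClassSqueeze :=
  FastClassSqueeze.fastClassSqueeze_of_noBlowup (noBlowup_of_navierStokesRegularity hA)

/-- **NECESSITY for crux 2: `NavierStokesRegularity → SlowClassProduction`.** Clay (A) rules out
blow-up (`noBlowup_of_navierStokesRegularity`), and without blow-up the slow-class production is
bounded up to `T` (`SlowClassProduction.NearField.slowClassProduction_of_noBlowup`: Fatou at `t = T`
plus persistence of regularity for the extension). [folklore] -/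
theorem slowClassProduction_of_navierStokesRegularity (hA : _root_.NavierStokesRegularity) :
    SlowClassProduction :=
  SlowClassProduction.NearField.slowClassProduction_of_noBlowup
    (noBlowup_of_navierStokesRegularity hA)

/-- Contrapositive of necessity: **refuting `FastClassSqueeze` refutes Clay (A)** — a
counterexample to crux 3 is a finite-time blow-up from a rapidly decaying datum. [folklore] -/
theorem not_navierStokesRegularity_of_not_fastClassSqueeze (h : ¬ FastClassSqueeze) :
    ¬ _root_.NavierStokesRegularity :=
  fun hA => h (fastClassSqueeze_of_navierStokesRegularity hA)

/-- Contrapositive of necessity: **refuting `SlowClassProduction` refutes Clay (A)**. [folklore] -/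
theorem not_navierStokesRegularity_of_not_slowClassProduction (h : ¬ SlowClassProduction) :
    ¬ _root_.NavierStokesRegularity :=
  fun hA => h (slowClassProduction_of_navierStokesRegularity hA)

/-- **SUFFICIENCY: the two open cruxes give Clay (A).** The route's deciding theorem `closes` with
its third hypothesis, the bridge crux `ClassBudgetsRegularise`, discharged by the tree theorem
`classBudgetsRegularise_proof` (Betchov–Miller enstrophy bound from the two class budgets at one
level, `H¹` continuation, per-datum Clay frame). [cite: Miller2019, Thm 1.1] -/
theorem navierStokesRegularity_of_classBudgets (h₁ : SlowClassProduction) (h₂ : FastClassSqueeze) :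
    _root_.NavierStokesRegularity := by
  -- buildfix 2026-08-19 (ops-buildfix lane): `closes` was re-cut at rev 8 (2026-08-17: `FastClassSqueeze`
  -- enters through its BC2 pieces NoFastEnergyConcentration / FastGradientSerrinStarved), so
  -- `closes h₁ h₂ classBudgetsRegularise_proof` no longer elaborates; this is the tail of the current
  -- `closes` body with `h₂ : FastClassSqueeze` supplied directly (statement unchanged).
  intro ν hν u₀ hs hd hdec
  refine classBudgetsRegularise_proof ν hν u₀ hs hd hdec ?_
  intro T hT u p hcl hLH h0
  have hdec0 : Literature.Analysis.FluidPDE.HasRapidSpatialDecay (u 0) := h0 ▸ hdec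
  obtain ⟨l, hl, hF⟩ := h₂ ν T hν hT u p hcl hLH hdec0
  exact ⟨l, hl, h₁ ν T hν hT u p hcl hLH hdec0 l hl, hF⟩

/-- **EQUIVALENCE: route `HodographBetchov` reformulates the Millennium statement.**
`NavierStokesRegularity ↔ SlowClassProduction ∧ FastClassSqueeze`: the two open cruxes are jointly
equivalent to Clay (A) — necessary by `…_of_navierStokesRegularity`, sufficient by
`navierStokesRegularity_of_classBudgets`. [cite: Miller2019, Thm 1.1] -/
theorem navierStokesRegularity_iff_classBudgets :
    _root_.NavierStokesRegularity ↔
      (Summit.NavierStokesRegularity.NavierStokesRegularity.Theses.HodographBetchov.SlowClassProduction ∧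
        Summit.NavierStokesRegularity.NavierStokesRegularity.Theses.HodographBetchov.FastClassSqueeze) :=
  ⟨fun hA => ⟨slowClassProduction_of_navierStokesRegularity hA,
      fastClassSqueeze_of_navierStokesRegularity hA⟩,
    fun h => navierStokesRegularity_of_classBudgets h.1 h.2⟩

/-- **Given the slow-class crux, `FastClassSqueeze` IS the Millennium statement.**
[cite: Miller2019, Thm 1.1] -/
theorem fastClassSqueeze_iff_navierStokesRegularity (h₁ : SlowClassProduction) :
    FastClassSqueeze ↔ _root_.NavierStokesRegularity :=
  ⟨fun h₂ => navierStokesRegularity_of_classBudgets h₁ h₂, fastClassSqueeze_of_navierStokesRegularity⟩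

/-- **Given the fast-class crux, `SlowClassProduction` IS the Millennium statement.**
[cite: Miller2019, Thm 1.1] -/
theorem slowClassProduction_iff_navierStokesRegularity (h₂ : FastClassSqueeze) :
    SlowClassProduction ↔ _root_.NavierStokesRegularity :=
  ⟨fun h₁ => navierStokesRegularity_of_classBudgets h₁ h₂, slowClassProduction_of_navierStokesRegularity⟩

/-- **A blow-up falsifies at least one crux.** If Clay (A) fails then `SlowClassProduction` or
`FastClassSqueeze` fails (contrapositive of `navierStokesRegularity_of_classBudgets`; the
per-solution, per-level form is `localisedMiller_proof`). [folklore] -/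
theorem not_slowClassProduction_or_not_fastClassSqueeze_of_not_navierStokesRegularity
    (h : ¬ _root_.NavierStokesRegularity) : ¬ SlowClassProduction ∨ ¬ FastClassSqueeze :=
  not_and_or.1 fun hb => h (navierStokesRegularity_of_classBudgets hb.1 hb.2)

end Summit.NavierStokesRegularity.NavierStokesRegularity.Theorems.HodographBetchov

end
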